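/-
Copyright (c) 2026. All rights reserved.
Released under Apache 2.0 license as described in the file LICENSE.
Authors: abc-iut cell, wave-4 seat abc-iut-w4-d059 (proof-only; sub-DAG [SemiAnbd] Thm 5.4, by-product hEV of
row T54-3c for the assembly of Thm 5.4 (ii), coordinator ruling R8).
-/
import Literature.AnabelianGeometry.SemiGraphs.ArithCompactInVerticialConj2
import HarnessLib

/-!
# [SemiAnbd] Thm 5.4: every edge-like subgroup is the intersection of two distinct verticial subgroups
# (over arithmetic level data)

Mochizuki, *Semi-graphs of anabelioids*, Publ. RIMS **42** (2006), §5, Theorem 5.4 (ii) p. 66 ("The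
arithmetically ample intersections of two distinct arithmetically maximal compact subgroups of `π₁^temp(𝔊)`
are precisely the edge-like subgroups") with the proof of Thm 3.7 (iv) p. 41 (on the universal pro-covering
tree `D_e = D_{v₁} ∩ D_{v₂}`) [cite: MochizukiSemiAnbd2006, Thm 5.4 (ii), p. 66].

PROOF-ONLY (no definition): the input `hEV` of abc-iut-w4-d085's assembly `arithMaximalCompactStatementII_of'`
(`ArithMaximalCompactReductions.lean`) — "every edge-like subgroup is `W₁ ⊓ W₂` for two DISTINCT verticial
`W₁`, `W₂`" — from the arithmetic level data in STABILISER form (sub-DAG T54 rulings R7/R8): `hstab` (the full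
stabiliser of a compatible tree-vertex system is verticial, two-sided), `hedgeFix` (an edge-like subgroup is
the full stabiliser of an eventual compatible tree-edge system, edge + branches, with its two compatible,
distinct end-vertex systems), `hnoswap`, `hequiv`, and the rigidity `hVE` "no verticial subgroup is edge-like".
Then `L = Stab(x₁) ⊓ Stab(x₂)` by `edge_fixed_of_ends_fixed` and the branch/abutment bookkeeping of
`arith_conj2_of_hstar`, and `Stab(x₁) ≠ Stab(x₂)` by `hVE`. Nothing here asserts a hypothesis of Thm 5.4 for
any data; nothing bears on [IUTchIII] Cor. 3.12.
-/

namespace Literature.AnabelianGeometry.SemiGraphs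

open CategoryTheory Topology

universe v u u' w w'

variable {Gtp : Type u} [Group Gtp]
variable {V : Type w} {B : Type w'}
variable (D : DecompositionData Gtp V B)
variable {J : Type v} [Preorder J] [IsDirectedOrder J]
  (T : J → SemiGraph.{u}) (ρ : ∀ j, Gtp →* Aut (T j)) (f : ∀ ⦃i j : J⦄, i ≤ j → (T j ⟶ T i))

/-- **hEV over arithmetic level data** ([SemiAnbd] Thm 5.4 (ii) / Thm 3.7 (iv) p. 41: `Π_e = Π_{v₁} ∩ Π_{v₂}`
for the two end-vertices of a tree edge): every edge-like subgroup is the intersection of two DISTINCT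
verticial subgroups — the stabilisers of the two end-vertex systems of its edge system.
[cite: MochizukiSemiAnbd2006, Thm 5.4 (ii), p. 66] -/
theorem exists_verticial_inf_eq_of_isEdgeLike_of_levelData (hT : ∀ j, (T j).IsTree)
    (hequiv : ∀ ⦃i j : J⦄ (h : i ≤ j) (g : Gtp) (x : (T j).Vertex),
      (f h).vertexMap ((ρ j g).hom.vertexMap x) = (ρ i g).hom.vertexMap ((f h).vertexMap x))
    (hnoswap : ∀ (j : J) (g : Gtp) (b : (T j).Branch),
      (ρ j g).hom.edgeMap ((T j).edgeOf b) = (T j).edgeOf b → (ρ j g).hom.branchMap b = b)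
    (hstab : ∀ x : ∀ j, (T j).Vertex, (∀ ⦃i j : J⦄ (h : i ≤ j), (f h).vertexMap (x j) = x i) →
      ∃ W : Subgroup Gtp, IsVerticial D W ∧ ∀ g : Gtp, g ∈ W ↔ ∀ j, (ρ j g).hom.vertexMap (x j) = x j)
    (hedgeFix : ∀ L : Subgroup Gtp, IsEdgeLike D L →
      ∃ (i : J) (ε : ∀ j : {j : J // i ≤ j}, (T j.1).Edge) (c c' : ∀ j : {j : J // i ≤ j}, (T j.1).Branch)
        (x₁ x₂ : ∀ j, (T j).Vertex),
        (∀ ⦃i' j : J⦄ (h : i' ≤ j), (f h).vertexMap (x₁ j) = x₁ i') ∧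
        (∀ ⦃i' j : J⦄ (h : i' ≤ j), (f h).vertexMap (x₂ j) = x₂ i') ∧
        (∀ j, x₁ j.1 ≠ x₂ j.1 ∧ (T j.1).edgeOf (c j) = ε j ∧ (T j.1).edgeOf (c' j) = ε j ∧
          (T j.1).abuts (c j) = some (x₁ j.1) ∧ (T j.1).abuts (c' j) = some (x₂ j.1)) ∧
        ∀ g : Gtp, g ∈ L ↔ ∀ j, (ρ j.1 g).hom.edgeMap (ε j) = ε j ∧
          ∀ b : (T j.1).Branch, (T j.1).edgeOf b = ε j → (ρ j.1 g).hom.branchMap b = b)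
    (hVE : ∀ K : Subgroup Gtp, IsVerticial D K → ¬ IsEdgeLike D K)
    (K : Subgroup Gtp) (hK : IsEdgeLike D K) :
    ∃ W₁ W₂ : Subgroup Gtp, IsVerticial D W₁ ∧ IsVerticial D W₂ ∧ W₁ ≠ W₂ ∧ K = W₁ ⊓ W₂ := by
  obtain ⟨i, ε, c, c', x₁, x₂, hx₁c, hx₂c, hdata, hKiff⟩ := hedgeFix K hK
  obtain ⟨W₁, hW₁, hW₁iff⟩ := hstab x₁ hx₁c
  obtain ⟨W₂, hW₂, hW₂iff⟩ := hstab x₂ hx₂c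
  -- `K = W₁ ⊓ W₂`
  have hKW : K = W₁ ⊓ W₂ := by
    ext g
    rw [Subgroup.mem_inf, hW₁iff g, hW₂iff g, hKiff g]
    constructor
    · intro hg
      -- `g` fixes the branches of `ε j`, hence both ends, for `j ≥ i`; then everywhere by compatibility
      have hends : ∀ j : {j : J // i ≤ j},
          (ρ j.1 g).hom.vertexMap (x₁ j.1) = x₁ j.1 ∧ (ρ j.1 g).hom.vertexMap (x₂ j.1) = x₂ j.1 := by
        intro j
        obtain ⟨-, hce, hc'e, hcx, hc'x⟩ := hdata j
        obtain ⟨-, hbr⟩ := hg j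
        have h1 := (ρ j.1 g).hom.abuts_branchMap (c j) (x₁ j.1) hcx
        have h2 := (ρ j.1 g).hom.abuts_branchMap (c' j) (x₂ j.1) hc'x
        rw [hbr (c j) hce, hcx] at h1
        rw [hbr (c' j) hc'e, hc'x] at h2
        exact ⟨(Option.some.inj h1).symm, (Option.some.inj h2).symm⟩
      have hall : ∀ j : J, (ρ j g).hom.vertexMap (x₁ j) = x₁ j ∧ (ρ j g).hom.vertexMap (x₂ j) = x₂ j := by
        intro j
        obtain ⟨k, hik, hjk⟩ := exists_ge_ge i j
        obtain ⟨h1, h2⟩ := hends ⟨k, hik⟩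
        constructor
        · rw [← hx₁c hjk, ← hequiv hjk g (x₁ k), h1]
        · rw [← hx₂c hjk, ← hequiv hjk g (x₂ k), h2]
      exact ⟨fun j => (hall j).1, fun j => (hall j).2⟩
    · rintro ⟨hg₁, hg₂⟩ j
      obtain ⟨hne, hce, hc'e, hcx, hc'x⟩ := hdata j
      exact edge_fixed_of_ends_fixed T ρ hT j.1 (hnoswap j.1) hne hce hc'e hcx hc'x g (hg₁ j.1) (hg₂ j.1)
  refine ⟨W₁, W₂, hW₁, hW₂, fun heq => ?_, hKW⟩
  -- `W₁ ≠ W₂`: otherwise `K = W₁` would be verticial AND edge-like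
  rw [← heq, inf_idem] at hKW
  exact hVE W₁ hW₁ (hKW ▸ hK)

end Literature.AnabelianGeometry.SemiGraphs
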